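/-
Width seat `ym-line-cbag-p1-w3` (prover-ym-line-cbag-p1-w3-g8-0), following its lead onto LINE 5 `route-QuantumFields-HankelDensitySplitting`:
REGISTERED STUB 1 `stub_hankelFixedDistanceLower : HankelFixedDistanceLower` of the birth skeleton of crux `HankelDensityFloor`
(stmt-QuantumFields-26618), BY NAME — the fixed-distance polynomial floor for the reflection-paired density correlator from the cross-plane
second-order local law.
-/
import Summits.QuantumFields.YangMills.Theorems.HankelDensitySplittingHankelDensityFloorDefs
import Summits.QuantumFields.YangMills.Theorems.HankelDensitySplittingCrossPlaneSecondOrder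
import Summits.QuantumFields.YangMills.Theorems.DirichletWindowLocalGaussianityStubExpMomentBound
import Summits.QuantumFields.YangMills.Theorems.DirichletWindowLocalGaussianityStubSecondOrderLocalLaw
import Summits.QuantumFields.YangMills.Theorems.DirichletWindowLocalGaussianityAxialKernel
import HarnessLib

/-!
# Crux `HankelDensityFloor` (stmt-QuantumFields-26618), stub 1: `stub_hankelFixedDistanceLower`

`HankelFixedDistanceLower` (`Theorems/HankelDensitySplittingHankelDensityFloorDefs.lean`): for every compact simple `G` and lattice representation
`r` there are `A > 0`, `n₀ ≥ 1` with, for every `n ≥ n₀`, eventually in `β` and uniformly over `μ ∈ infiniteVolumeLimitPoints r.ρ β`,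
`A/(β² n⁸) ≤ F_μ(n)`, `F_μ(n) = Σ_{0<j, k<l} plaquetteCorr(0;0j | n e₀;kl) + Σ_{0<i<j, k<l} plaquetteCorr(0;ij | (n−1) e₀;kl)` (`hF`).

Proof (`A = D κ₀²/4`, `n₀ = 1`, `κ₀ = (2/3)(2π)⁻³/32768`): by the cross-plane second-order local law `CrossPlane.secondOrder_pair_of_expMoment` (fed
with the CLOSED free-energy asymptotics `DirichletWindow.FreeEnergyLogCoefficient_holds` and the landed chessboard exponential moments
`stub_expMomentBound`, transported to every plane by `CrossPlane.expMoment_allPlanes`), every one of the `64 + 256` summands of `β²·F_μ(n)` is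
eventually `≥ −δ` (its limit `(D/2)·K(p,q)² ≥ 0`), and the summand `(0;0,1) | (n e₀;0,1)` is eventually `≥ (D/2)κ₀²/n⁸ − δ`
(`AxialKernel.abs_curvatureTwoPoint_inPlane_ge`: `|K| ≥ κ₀/n⁴`); with `δ = (D/2)κ₀² n⁻⁸/640` this gives `β² F_μ(n) ≥ D κ₀²/(4 n⁸)`.

No sorry; standard axioms.  RECORD-type material (node `LatticeNonFreezing`); the Yang–Mills mass gap is NOT proved by anything here.
-/

set_option autoImplicit false

noncomputable section

open MeasureTheory Filter Topology
open Literature.MathematicalPhysics.QuantumFieldTheory Literature.MathematicalPhysics.QuantumLattice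
open Literature.Probability.LatticeModels (Site)
open Summit.QuantumFields.YangMills.Theorems.LocalGaussianityExpMomentTangentLaw
open Summit.QuantumFields.YangMills.Cruxes.LocalGaussianity.ExpMomentTangentLaw (stub_expMomentBound)

namespace Summit.QuantumFields.YangMills.Theorems.HankelDensitySplitting

/-- `n • e₀` written with `Pi.single`. -/
theorem natSmul_single_eq (n : ℕ) : ((n : ℤ) • Pi.single (0 : Fin 4) (1 : ℤ) : Site 4) = Pi.single (0 : Fin 4) (n : ℤ) := by
  ext i
  by_cases hi : i = 0
  · subst hi; simp
  · simp [hi]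

/-- **STUB 1 of the registered skeleton of crux `HankelDensityFloor` (stmt-QuantumFields-26618), proved: `HankelFixedDistanceLower`.**
`A/(β² n⁸) ≤ F_μ(n)` for every `n ≥ 1`, eventually in `β`, uniformly over the limit states, with `A = D κ₀²/4` — the cross-plane second-order
local law summed over the `320` plane pairs of the composite, the in-line axial pair carrying the signal. -/
theorem stub_hankelFixedDistanceLower : HankelFixedDistanceLower := by
  intro G _ _ _ _ mG hBG hG r
  have hm : mG = borel G := @BorelSpace.measurable_eq G _ mG hBG
  subst hm
  letI : MeasurableSpace G := borel G
  obtain ⟨C, β₁, hC⟩ := stub_expMomentBound G hG r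
  obtain ⟨D, hD, hlaw⟩ := CrossPlane.secondOrder_pair_of_expMoment G hG r
    (Summit.QuantumFields.YangMills.Theses.DirichletWindow.FreeEnergyLogCoefficient_holds G hG r)
    ⟨C, β₁, fun β hβ μ hμ x i j hij => CrossPlane.expMoment_allPlanes r.ρ r.continuous (hC β hβ) hμ x hij⟩
  set κ₀ : ℝ := 2 / 3 / (2 * Real.pi) ^ 3 / 32768 with hκ₀
  have hκ₀0 : 0 < κ₀ := by positivity
  have hD0 : (0 : ℝ) < D := by exact_mod_cast hD
  refine ⟨(D : ℝ) * κ₀ ^ 2 / 4, 1, by positivity, le_rfl, fun n hn => ?_⟩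
  have hn0 : (0 : ℝ) < n := by exact_mod_cast hn
  set S : ℝ := (D : ℝ) / 2 * (κ₀ ^ 2 / (n : ℝ) ^ 8) with hS
  have hS0 : 0 < S := by positivity
  set δ : ℝ := S / 640 with hδ
  have hδ0 : 0 < δ := by positivity
  have h01 : (0 : Fin 4) < 1 := Fin.zero_lt_one
  -- per-summand eventual lower bounds, first block
  have key1 : ∀ j k l : Fin 4, ∀ᶠ β : ℝ in atTop, ∀ μ ∈ infiniteVolumeLimitPoints (d := 4) r.ρ β,
      0 ≤ β ^ 2 * (if 0 < j ∧ k < l then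
        plaquetteCorr r.ρ μ 0 0 j ((n : ℤ) • Pi.single (0 : Fin 4) (1 : ℤ)) k l else 0) + δ := by
    intro j k l
    by_cases h : 0 < j ∧ k < l
    · obtain ⟨β₂, hβ₂⟩ := hlaw ⟨0, ⟨(0, j), h.1⟩⟩ ⟨(n : ℤ) • Pi.single (0 : Fin 4) (1 : ℤ), ⟨(k, l), h.2⟩⟩ δ hδ0
      filter_upwards [eventually_ge_atTop β₂] with β hβ μ hμ
      have h1 := hβ₂ β hβ μ hμ
      dsimp only at h1
      rw [if_pos h]
      have h2 : 0 ≤ (D : ℝ) / 2 * curvatureTwoPoint (⟨0, ⟨(0, j), h.1⟩⟩ : ZdPlaquette 4)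
          ⟨(n : ℤ) • Pi.single (0 : Fin 4) (1 : ℤ), ⟨(k, l), h.2⟩⟩ ^ 2 := by positivity
      linarith [(abs_lt.1 h1).1]
    · exact Filter.Eventually.of_forall fun β μ _ => by rw [if_neg h, mul_zero, zero_add]; exact hδ0.le
  -- second block
  have key2 : ∀ i j k l : Fin 4, ∀ᶠ β : ℝ in atTop, ∀ μ ∈ infiniteVolumeLimitPoints (d := 4) r.ρ β,
      0 ≤ β ^ 2 * (if 0 < i ∧ i < j ∧ k < l then
        plaquetteCorr r.ρ μ 0 i j (((n - 1 : ℕ) : ℤ) • Pi.single (0 : Fin 4) (1 : ℤ)) k l else 0) + δ := by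
    intro i j k l
    by_cases h : 0 < i ∧ i < j ∧ k < l
    · obtain ⟨β₂, hβ₂⟩ := hlaw ⟨0, ⟨(i, j), h.2.1⟩⟩ ⟨((n - 1 : ℕ) : ℤ) • Pi.single (0 : Fin 4) (1 : ℤ), ⟨(k, l), h.2.2⟩⟩ δ hδ0
      filter_upwards [eventually_ge_atTop β₂] with β hβ μ hμ
      have h1 := hβ₂ β hβ μ hμ
      dsimp only at h1
      rw [if_pos h]
      have h2 : 0 ≤ (D : ℝ) / 2 * curvatureTwoPoint (⟨0, ⟨(i, j), h.2.1⟩⟩ : ZdPlaquette 4)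
          ⟨((n - 1 : ℕ) : ℤ) • Pi.single (0 : Fin 4) (1 : ℤ), ⟨(k, l), h.2.2⟩⟩ ^ 2 := by positivity
      linarith [(abs_lt.1 h1).1]
    · exact Filter.Eventually.of_forall fun β μ _ => by rw [if_neg h, mul_zero, zero_add]; exact hδ0.le
  -- the signal: the in-line axial pair
  have key0 : ∀ᶠ β : ℝ in atTop, ∀ μ ∈ infiniteVolumeLimitPoints (d := 4) r.ρ β,
      S - δ ≤ β ^ 2 * plaquetteCorr r.ρ μ 0 0 1 ((n : ℤ) • Pi.single (0 : Fin 4) (1 : ℤ)) 0 1 := by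
    obtain ⟨β₂, hβ₂⟩ := hlaw ⟨0, ⟨(0, 1), h01⟩⟩ ⟨(n : ℤ) • Pi.single (0 : Fin 4) (1 : ℤ), ⟨(0, 1), h01⟩⟩ δ hδ0
    have hK : κ₀ / (n : ℝ) ^ 4 ≤ |curvatureTwoPoint (⟨0, ⟨(0, 1), h01⟩⟩ : ZdPlaquette 4)
        ⟨(n : ℤ) • Pi.single (0 : Fin 4) (1 : ℤ), ⟨(0, 1), h01⟩⟩| := by
      have h := AxialKernel.abs_curvatureTwoPoint_inPlane_ge n hn
      rw [natSmul_single_eq, hκ₀]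
      exact h
    have hK2 : κ₀ ^ 2 / (n : ℝ) ^ 8 ≤ curvatureTwoPoint (⟨0, ⟨(0, 1), h01⟩⟩ : ZdPlaquette 4)
        ⟨(n : ℤ) • Pi.single (0 : Fin 4) (1 : ℤ), ⟨(0, 1), h01⟩⟩ ^ 2 := by
      have h0 : 0 ≤ κ₀ / (n : ℝ) ^ 4 := by positivity
      have h2 := pow_le_pow_left₀ h0 hK 2
      rw [sq_abs, div_pow, ← pow_mul] at h2
      norm_num at h2
      exact h2
    have hS' : S ≤ (D : ℝ) / 2 * curvatureTwoPoint (⟨0, ⟨(0, 1), h01⟩⟩ : ZdPlaquette 4)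
        ⟨(n : ℤ) • Pi.single (0 : Fin 4) (1 : ℤ), ⟨(0, 1), h01⟩⟩ ^ 2 := by
      rw [hS]; exact mul_le_mul_of_nonneg_left hK2 (by positivity)
    filter_upwards [eventually_ge_atTop β₂] with β hβ μ hμ
    have h1 := hβ₂ β hβ μ hμ
    dsimp only at h1
    linarith [(abs_lt.1 h1).1]
  -- all summands at once
  have hall1 := Filter.eventually_all.2 fun jkl : Fin 4 × Fin 4 × Fin 4 => key1 jkl.1 jkl.2.1 jkl.2.2
  have hall2 := Filter.eventually_all.2 fun ijkl : Fin 4 × Fin 4 × Fin 4 × Fin 4 => key2 ijkl.1 ijkl.2.1 ijkl.2.2.1 ijkl.2.2.2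
  obtain ⟨β₃, hβ₃⟩ := Filter.eventually_atTop.1 ((key0.and (hall1.and hall2)).and (eventually_ge_atTop (1 : ℝ)))
  refine ⟨β₃, fun β hβ μ hμ => ?_⟩
  obtain ⟨⟨h0, h1, h2⟩, hβ1⟩ := hβ₃ β hβ
  have hβ0 : 0 < β := by linarith
  -- block 1: the signal survives
  have hB1 : S - 64 * δ ≤ β ^ 2 * ∑ j : Fin 4, ∑ k : Fin 4, ∑ l : Fin 4,
      (if 0 < j ∧ k < l then plaquetteCorr r.ρ μ 0 0 j ((n : ℤ) • Pi.single (0 : Fin 4) (1 : ℤ)) k l else 0) := by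
    set g : Fin 4 → Fin 4 → Fin 4 → ℝ := fun j k l =>
      β ^ 2 * (if 0 < j ∧ k < l then plaquetteCorr r.ρ μ 0 0 j ((n : ℤ) • Pi.single (0 : Fin 4) (1 : ℤ)) k l else 0) + δ
      with hg
    have hg0 : ∀ j k l, 0 ≤ g j k l := fun j k l => h1 ⟨j, k, l⟩ μ hμ
    have hsum : ∑ j, ∑ k, ∑ l, g j k l = β ^ 2 * (∑ j : Fin 4, ∑ k : Fin 4, ∑ l : Fin 4,
        (if 0 < j ∧ k < l then plaquetteCorr r.ρ μ 0 0 j ((n : ℤ) • Pi.single (0 : Fin 4) (1 : ℤ)) k l else 0)) + 64 * δ := by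
      simp only [hg, Finset.sum_add_distrib, Finset.sum_const, Finset.card_univ, Fintype.card_fin, Finset.mul_sum]
      ring
    have hsp : g 1 0 1 ≤ ∑ j, ∑ k, ∑ l, g j k l :=
      calc g 1 0 1 ≤ ∑ l, g 1 0 l := Finset.single_le_sum (f := fun l => g 1 0 l) (fun l _ => hg0 1 0 l) (Finset.mem_univ 1)
        _ ≤ ∑ k, ∑ l, g 1 k l :=
            Finset.single_le_sum (f := fun k => ∑ l, g 1 k l) (fun k _ => Finset.sum_nonneg fun l _ => hg0 1 k l) (Finset.mem_univ 0)
        _ ≤ ∑ j, ∑ k, ∑ l, g j k l :=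
            Finset.single_le_sum (f := fun j => ∑ k, ∑ l, g j k l)
              (fun j _ => Finset.sum_nonneg fun k _ => Finset.sum_nonneg fun l _ => hg0 j k l) (Finset.mem_univ 1)
    have hg101 : g 1 0 1 = β ^ 2 * plaquetteCorr r.ρ μ 0 0 1 ((n : ℤ) • Pi.single (0 : Fin 4) (1 : ℤ)) 0 1 + δ := by
      simp only [hg]; rw [if_pos ⟨h01, h01⟩]
    have hs := h0 μ hμ
    linarith [hsum, hsp, hg101]
  -- block 2: no worse than `−256 δ`
  have hB2 : -(256 * δ) ≤ β ^ 2 * ∑ i : Fin 4, ∑ j : Fin 4, ∑ k : Fin 4, ∑ l : Fin 4,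
      (if 0 < i ∧ i < j ∧ k < l then
        plaquetteCorr r.ρ μ 0 i j (((n - 1 : ℕ) : ℤ) • Pi.single (0 : Fin 4) (1 : ℤ)) k l else 0) := by
    set g : Fin 4 → Fin 4 → Fin 4 → Fin 4 → ℝ := fun i j k l =>
      β ^ 2 * (if 0 < i ∧ i < j ∧ k < l then
        plaquetteCorr r.ρ μ 0 i j (((n - 1 : ℕ) : ℤ) • Pi.single (0 : Fin 4) (1 : ℤ)) k l else 0) + δ with hg
    have hg0 : ∀ i j k l, 0 ≤ g i j k l := fun i j k l => h2 ⟨i, j, k, l⟩ μ hμ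
    have hsum : ∑ i, ∑ j, ∑ k, ∑ l, g i j k l = β ^ 2 * (∑ i : Fin 4, ∑ j : Fin 4, ∑ k : Fin 4, ∑ l : Fin 4,
        (if 0 < i ∧ i < j ∧ k < l then
          plaquetteCorr r.ρ μ 0 i j (((n - 1 : ℕ) : ℤ) • Pi.single (0 : Fin 4) (1 : ℤ)) k l else 0)) + 256 * δ := by
      simp only [hg, Finset.sum_add_distrib, Finset.sum_const, Finset.card_univ, Fintype.card_fin, Finset.mul_sum]
      ring
    have hnn : 0 ≤ ∑ i, ∑ j, ∑ k, ∑ l, g i j k l :=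
      Finset.sum_nonneg fun i _ => Finset.sum_nonneg fun j _ => Finset.sum_nonneg fun k _ => Finset.sum_nonneg fun l _ => hg0 i j k l
    linarith [hsum, hnn]
  -- conclusion
  have hFβ : S - 320 * δ ≤ β ^ 2 * hF r.ρ μ n := by
    unfold hF
    rw [mul_add]
    linarith [hB1, hB2]
  have hn8 : (n : ℝ) ^ 8 ≠ 0 := by positivity
  have hx : (D : ℝ) * κ₀ ^ 2 / 4 = (S - 320 * δ) * (n : ℝ) ^ 8 := by
    rw [hδ, hS]; field_simp; ring
  rw [div_le_iff₀ (by positivity), hx]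
  have h3 := mul_le_mul_of_nonneg_right hFβ (by positivity : (0 : ℝ) ≤ (n : ℝ) ^ 8)
  linarith [h3]

end Summit.QuantumFields.YangMills.Theorems.HankelDensitySplitting

end
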